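import Summits.BirchSwinnertonDyer.BirchSwinnertonDyer.Theses.GenusKolyvaginAtTwo
import Summits.BirchSwinnertonDyer.BirchSwinnertonDyer.Theorems.GenusKolyvaginAtTwoMinimalTwinBSDTwoKrizLiAnchor91a1
import Summits.BirchSwinnertonDyer.BirchSwinnertonDyer.Theorems.GenusKolyvaginAtTwoMinimalTwinBSDTwoKrizLiAnchor91b1
import Summits.BirchSwinnertonDyer.BirchSwinnertonDyer.Theorems.GenusKolyvaginAtTwoMinimalTwinBSDTwoKrizLiAnchorsSupersingularWallIII
import Summits.BirchSwinnertonDyer.BirchSwinnertonDyer.Theorems.GenusKolyvaginAtTwoMinimalTwinBSDTwoKrizLiAnchor196a1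
import HarnessLib

/-!
# Route `GenusKolyvaginAtTwo`, crux U₂ `MinimalTwinBSDTwo` (stmt-BirchSwinnertonDyer-22985), LINE 23 «twin_swap»: THE g35 KRIZ–LI ANCHOR ROADS KEYED BY NAME ON
# THE ROUTE'S OWN WALL ITEMS `WallSupersingularRankZeroAtTwo` (19097's copy in route GenusKolyvaginAtTwo) and `WallAdditiveRankZeroAtTwo` — the displayed
# wall rows `hSS` / `hAdd` of `…KrizLiAnchor91a1/91b1/196a1.lean` and `…KrizLiAnchorsSupersingularWallIII.lean` ARE those route declarations verbatim

Seat `bsd-line-gk2-p2` g35 (PROVER 2/3, cell `bsd-f1-sign2`; LINE 23 holder), `--supports stmt-BirchSwinnertonDyer-22985` (helper; closes nothing).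
THEOREMS ONLY (0 `def`, 0 `sorry`); standard axioms.  HONEST FRAMING (D-0014/D-0036): pure re-keying — each theorem is the corresponding `…_of_ssWall` /
additive-wall theorem with its displayed hypothesis replaced by the ROUTE ITEM by name (`Summit.….Theses.GenusKolyvaginAtTwo.WallSupersingularRankZeroAtTwo` =
«∀ non-CM W of analytic rank 0 good supersingular at 2, BSDp W 2»; `…WallAdditiveRankZeroAtTwo` = «… additive at 2 …»), so that a reader of the route sees
which of ITS cruxes each sub-cell of U₂ consumes: the rank-one members of the Kriz–Li packets of `91a1`, `91b1`, `189a1`, `189b1` need PRINT + the supersingular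
wall item; those of `196a1` need PRINT (+ ARS) + the additive wall item; those of `11a1`, `37b1`, `67a1` (Table 2) and `37a1`, `43a1` (Table 1) need PRINT alone
(`…KrizLiAnchor11a1/37b1/67a1/37a1/43a1.lean`, no wall).  The anchors' own `r_an = 1` uses GZK (`hGZK`).  The route items are OPEN research statements; nothing
is discharged.  **BSD is NOT proved by any of this; U₂ is NOT proved; no item is closed.**

References: [KrizLi2019] Thm 5.1 (2), Thm 4.3, §6 Table 1; [CreutzMiller2012] Thm 1.1; [AgasheRibetStein2006] Thm. 2.6.
-/

set_option autoImplicit false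
-- the Theorems namespace of this sub repeats the summit name by design (D-0017 nested layout)
set_option linter.dupNamespace false

noncomputable section

open scoped Classical

open WeierstrassCurve NumberField Literature.NumberTheory.EllipticCurves
  Literature.NumberTheory.EllipticCurves.ModularForms
  Literature.NumberTheory.EllipticCurves.Rank1Residual
  Literature.NumberTheory.EllipticCurves.Rank1Residual.Typed
  Summit.BirchSwinnertonDyer.Rank1Residual
  Summit.BirchSwinnertonDyer.Rank1Residual.P2
  Literature.NumberTheory.EllipticCurves.AgasheRibetStein2006

namespace Summit.BirchSwinnertonDyer.BirchSwinnertonDyer.Theorems.GenusExact.TwinSwap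

/-- **The rank-one members `91a1^{(d)}` keyed BY NAME on the route item `WallSupersingularRankZeroAtTwo`** (`d ∈ 𝒩(91a1, K)`, `d_K = -55`, `χ_d(−N) = 1`):
`r_an(W₁) = 1 ∧ ¬CM ∧ BSD(W₁, 2)` modulo PRINT + that ONE route item (+ GZK for the anchor's rank); witness member `91a1^{(-31)}` (`N = 87451`) included by `d := -31`.
BSD is not proved by any of this. [cite: KrizLi2019, Thm. 5.1 (2), Thm. 4.3, §6 Table 1 (row 91a1)] [cite: CreutzMiller2012, Thm. 1.1] -/
theorem rankOneMembers_91A1_of_routeWallSS (hKL : KrizLi2019.thm112_bsdTwo_twist) (h33 : KrizLi2019.thm33_rank_twist)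
    (htab : KrizLi2019.table1_row91a1) (hS31 : bsdTriple_of_analyticRank_le_one_of_conductor_lt)
    (hGZK : rank_eq_analyticRank_of_analyticRank_le_one)
    (hWall : Summit.BirchSwinnertonDyer.BirchSwinnertonDyer.Theses.GenusKolyvaginAtTwo.WallSupersingularRankZeroAtTwo)
    (K : Type) [Field K] [NumberField K] (hK : IsImaginaryQuadratic K) (hdK : NumberField.discr K = -55)
    {d : ℤ} (hd : haveI := KrizLiAnchor91a1.isGloballyMinimal_91A1; KrizLi2019.InN (⟨0, 0, 1, 1, 0⟩ : WeierstrassCurve ℚ) K d)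
    (hsign : haveI := KrizLiAnchor91a1.isElliptic_91A1; Int.sign d * jacobiSym ((⟨0, 0, 1, 1, 0⟩ : WeierstrassCurve ℚ).conductorNorm ℤ) d.natAbs = 1)
    (W₁ : WeierstrassCurve ℚ) [W₁.IsElliptic] [W₁.IsGloballyMinimal]
    (hW₁ : ∃ C : VariableChange ℚ, C • (⟨0, 0, 1, 1, 0⟩ : WeierstrassCurve ℚ).quadraticTwist (d : ℚ) = W₁) :
    W₁.analyticRank = 1 ∧ ¬ W₁.HasCM ∧ BSDp W₁ 2 :=
  KrizLiAnchor91a1.rankOneMembers_91A1_of_ssWall hKL h33 htab hS31 hGZK (fun W _ _ h₁ h₂ h₃ => hWall W h₁ h₂ h₃) K hK hdK hd hsign W₁ hW₁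

/-- **The rank-one members `91b1^{(d)}` keyed BY NAME on the route item `WallSupersingularRankZeroAtTwo`** (`d ∈ 𝒩(91b1, K)`, `d_K = -55`, `χ_d(−N) = 1`):
`r_an(W₁) = 1 ∧ ¬CM ∧ BSD(W₁, 2)` modulo PRINT + that ONE route item (+ GZK for the anchor's rank); witness member `91b1^{(-31)}` (`N = 87451`) included by `d := -31`.
BSD is not proved by any of this. [cite: KrizLi2019, Thm. 5.1 (2), Thm. 4.3, §6 Table 1 (row 91b1)] [cite: CreutzMiller2012, Thm. 1.1] -/
theorem rankOneMembers_91B1_of_routeWallSS (hKL : KrizLi2019.thm112_bsdTwo_twist) (h33 : KrizLi2019.thm33_rank_twist)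
    (htab : KrizLi2019.table1_row91b1) (hS31 : bsdTriple_of_analyticRank_le_one_of_conductor_lt)
    (hGZK : rank_eq_analyticRank_of_analyticRank_le_one)
    (hWall : Summit.BirchSwinnertonDyer.BirchSwinnertonDyer.Theses.GenusKolyvaginAtTwo.WallSupersingularRankZeroAtTwo)
    (K : Type) [Field K] [NumberField K] (hK : IsImaginaryQuadratic K) (hdK : NumberField.discr K = -55)
    {d : ℤ} (hd : haveI := KrizLiAnchor91b1.isGloballyMinimal_91B1; KrizLi2019.InN (⟨0, 1, 1, -7, 5⟩ : WeierstrassCurve ℚ) K d)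
    (hsign : haveI := KrizLiAnchor91b1.isElliptic_91B1; Int.sign d * jacobiSym ((⟨0, 1, 1, -7, 5⟩ : WeierstrassCurve ℚ).conductorNorm ℤ) d.natAbs = 1)
    (W₁ : WeierstrassCurve ℚ) [W₁.IsElliptic] [W₁.IsGloballyMinimal]
    (hW₁ : ∃ C : VariableChange ℚ, C • (⟨0, 1, 1, -7, 5⟩ : WeierstrassCurve ℚ).quadraticTwist (d : ℚ) = W₁) :
    W₁.analyticRank = 1 ∧ ¬ W₁.HasCM ∧ BSDp W₁ 2 :=
  KrizLiAnchor91b1.rankOneMembers_91B1_of_ssWall hKL h33 htab hS31 hGZK (fun W _ _ h₁ h₂ h₃ => hWall W h₁ h₂ h₃) K hK hdK hd hsign W₁ hW₁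

/-- **The rank-one members `189a1^{(d)}` keyed BY NAME on the route item `WallSupersingularRankZeroAtTwo`** (`d ∈ 𝒩(189a1, K)`, `d_K = -47`, `χ_d(−N) = 1`):
`r_an(W₁) = 1 ∧ ¬CM ∧ BSD(W₁, 2)` modulo PRINT + that ONE route item (+ GZK for the anchor's rank); witness member `189a1^{(17)}` (`N = 54621`) included by `d := 17`.
BSD is not proved by any of this. [cite: KrizLi2019, Thm. 5.1 (2), Thm. 4.3, §6 Table 1 (row 189a1)] [cite: CreutzMiller2012, Thm. 1.1] -/
theorem rankOneMembers_189A1_of_routeWallSS (hKL : KrizLi2019.thm112_bsdTwo_twist) (h33 : KrizLi2019.thm33_rank_twist)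
    (htab : KrizLi2019.table1_row189a1) (hS31 : bsdTriple_of_analyticRank_le_one_of_conductor_lt)
    (hGZK : rank_eq_analyticRank_of_analyticRank_le_one)
    (hWall : Summit.BirchSwinnertonDyer.BirchSwinnertonDyer.Theses.GenusKolyvaginAtTwo.WallSupersingularRankZeroAtTwo)
    (K : Type) [Field K] [NumberField K] (hK : IsImaginaryQuadratic K) (hdK : NumberField.discr K = -47)
    {d : ℤ} (hd : haveI := Summit.BirchSwinnertonDyer.BirchSwinnertonDyer.Theorems.ManinLocalTwoThree.LevelOneEightyNine.isGloballyMinimal_a; KrizLi2019.InN (⟨0, 0, 1, -3, 0⟩ : WeierstrassCurve ℚ) K d)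
    (hsign : haveI := Summit.BirchSwinnertonDyer.BirchSwinnertonDyer.Theorems.ManinLocalTwoThree.LevelOneEightyNine.isElliptic_a; Int.sign d * jacobiSym ((⟨0, 0, 1, -3, 0⟩ : WeierstrassCurve ℚ).conductorNorm ℤ) d.natAbs = 1)
    (W₁ : WeierstrassCurve ℚ) [W₁.IsElliptic] [W₁.IsGloballyMinimal]
    (hW₁ : ∃ C : VariableChange ℚ, C • (⟨0, 0, 1, -3, 0⟩ : WeierstrassCurve ℚ).quadraticTwist (d : ℚ) = W₁) :
    W₁.analyticRank = 1 ∧ ¬ W₁.HasCM ∧ BSDp W₁ 2 :=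
  KrizLiAnchorsSSIII.rankOneMembers_189A1_of_ssWall hKL h33 htab hS31 hGZK (fun W _ _ h₁ h₂ h₃ => hWall W h₁ h₂ h₃) K hK hdK hd hsign W₁ hW₁

/-- **The rank-one members `189b1^{(d)}` keyed BY NAME on the route item `WallSupersingularRankZeroAtTwo`** (`d ∈ 𝒩(189b1, K)`, `d_K = -47`, `χ_d(−N) = 1`):
`r_an(W₁) = 1 ∧ ¬CM ∧ BSD(W₁, 2)` modulo PRINT + that ONE route item (+ GZK for the anchor's rank); witness member `189b1^{(17)}` (`N = 54621`) included by `d := 17`.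
BSD is not proved by any of this. [cite: KrizLi2019, Thm. 5.1 (2), Thm. 4.3, §6 Table 1 (row 189b1)] [cite: CreutzMiller2012, Thm. 1.1] -/
theorem rankOneMembers_189B1_of_routeWallSS (hKL : KrizLi2019.thm112_bsdTwo_twist) (h33 : KrizLi2019.thm33_rank_twist)
    (htab : KrizLi2019.table1_row189b1) (hS31 : bsdTriple_of_analyticRank_le_one_of_conductor_lt)
    (hGZK : rank_eq_analyticRank_of_analyticRank_le_one)
    (hWall : Summit.BirchSwinnertonDyer.BirchSwinnertonDyer.Theses.GenusKolyvaginAtTwo.WallSupersingularRankZeroAtTwo)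
    (K : Type) [Field K] [NumberField K] (hK : IsImaginaryQuadratic K) (hdK : NumberField.discr K = -47)
    {d : ℤ} (hd : haveI := KrizLiAnchor189b1.isGloballyMinimal_189B1; KrizLi2019.InN (⟨0, 0, 1, -24, 45⟩ : WeierstrassCurve ℚ) K d)
    (hsign : haveI := KrizLiAnchor189b1.isElliptic_189B1; Int.sign d * jacobiSym ((⟨0, 0, 1, -24, 45⟩ : WeierstrassCurve ℚ).conductorNorm ℤ) d.natAbs = 1)
    (W₁ : WeierstrassCurve ℚ) [W₁.IsElliptic] [W₁.IsGloballyMinimal]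
    (hW₁ : ∃ C : VariableChange ℚ, C • (⟨0, 0, 1, -24, 45⟩ : WeierstrassCurve ℚ).quadraticTwist (d : ℚ) = W₁) :
    W₁.analyticRank = 1 ∧ ¬ W₁.HasCM ∧ BSDp W₁ 2 :=
  KrizLiAnchorsSSIII.rankOneMembers_189B1_of_ssWall hKL h33 htab hS31 hGZK (fun W _ _ h₁ h₂ h₃ => hWall W h₁ h₂ h₃) K hK hdK hd hsign W₁ hW₁

/-- **The rank-one members `196a1^{(d)}` keyed BY NAME on the route item `WallAdditiveRankZeroAtTwo`** (`d ∈ 𝒩(196a1, K)`, `d_K = -31`, `χ_d(−196) = 1`):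
`r_an(W₁) = 1 ∧ ¬CM ∧ BSD(W₁, 2)` modulo PRINT (incl. ARS `h26`) + that ONE route item (+ GZK).  BSD is not proved by any of this.
[cite: KrizLi2019, Thm. 5.1 (2), Thm. 4.3, §6 Table 1 (row 196a1)] [cite: CreutzMiller2012, Thm. 1.1] [cite: AgasheRibetStein2006, Thm. 2.6] -/
theorem rankOneMembers_196A1_of_routeWallAdd (hKL : KrizLi2019.thm112_bsdTwo_twist) (h33 : KrizLi2019.thm33_rank_twist)
    (htab : KrizLi2019.table1_row196a1) (hS31 : bsdTriple_of_analyticRank_le_one_of_conductor_lt)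
    (hGZK : rank_eq_analyticRank_of_analyticRank_le_one)
    (h26 : cremona_abs_maninConstant_eq_one_of_level_le)
    (hWall : Summit.BirchSwinnertonDyer.BirchSwinnertonDyer.Theses.GenusKolyvaginAtTwo.WallAdditiveRankZeroAtTwo)
    (K : Type) [Field K] [NumberField K] (hK : IsImaginaryQuadratic K) (hdK : NumberField.discr K = -31)
    {d : ℤ} (hd : haveI := KrizLiAnchor196a1.isGloballyMinimal_196A1; KrizLi2019.InN (⟨0, -1, 0, -2, 1⟩ : WeierstrassCurve ℚ) K d)
    (hsign : haveI := KrizLiAnchor196a1.isElliptic_196A1; Int.sign d * jacobiSym ((⟨0, -1, 0, -2, 1⟩ : WeierstrassCurve ℚ).conductorNorm ℤ) d.natAbs = 1)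
    (W₁ : WeierstrassCurve ℚ) [W₁.IsElliptic] [W₁.IsGloballyMinimal]
    (hW₁ : ∃ C : VariableChange ℚ, C • (⟨0, -1, 0, -2, 1⟩ : WeierstrassCurve ℚ).quadraticTwist (d : ℚ) = W₁) :
    W₁.analyticRank = 1 ∧ ¬ W₁.HasCM ∧ BSDp W₁ 2 :=
  KrizLiAnchor196a1.rankOneMembers_196A1 hKL h33 htab hS31 hGZK h26 (fun W _ _ h₁ h₂ h₃ => hWall W h₁ h₂ h₃) K hK hdK hd hsign W₁ hW₁

end Summit.BirchSwinnertonDyer.BirchSwinnertonDyer.Theorems.GenusExact.TwinSwap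

end
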